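import Summits.MatrixMultiplication.MatrixMultiplication.Theorems.FarEdgeDescentTStarDoor
import HarnessLib

/-!
# Symmetries of the same-support stratum of `⟨2,2,2⟩`: the inversion involution of the BCZ line and the rotation carrying `𝔖^ᵀ` to `C₁`

Route `FarEdgeDescent` (cell `decomp-mm`, lens 2 «structural dichotomy (special vs generic)»,
gen 34), Kernel IX-c/IX-a; support for the aside `SubLogRate` (stmt-MatrixMultiplication-25371).

The lens reads the same-support stratum of `⟨2,2,2⟩` in BCZ normal form as the line `q ↦ 𝔖(q)`
(`fam`, plain class) plus the transposed class `𝔖^{wᵀ}`; the special point is `𝔖(1) = ⟨2,2,2⟩`.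
Two symmetries organise «special vs generic» on it, both hypothesis-free and `ω`-free:

* §1–2 **The inversion involution.**  For every nowhere-zero weight table `w`, swapping the two leaves
  and rescaling the middle leg by `w⁻¹` carries `𝔖^w` to `𝔖^{w⁻¹}` as a RESTRICTION both ways
  (`weightedStar_restrictsTo_inv`, explicit monomial matrices); hence every universal spectral
  point and `R̃` agree on the two
  (`spectralPoint_weightedStar_inv`, `asymptoticRank_weightedStar_inv`).  On the BCZ line this is the
  Möbius involution `q ↦ q⁻¹` (`famW_inv`): **`F(𝔖(q⁻¹)) = F(𝔖(q))` and `R̃(𝔖(q⁻¹)) = R̃(𝔖(q))` for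
  every `q`** (`spectralPoint_fam_inv`, `asymptoticRank_fam_inv`; at `q = 0` trivially).  So the flat
  set, the special set below any level, the dominant moduli and the spectral twins of `⟨2,2,2⟩` are all
  closed under `q ↦ q⁻¹` (`flat_inv_iff`, `lt_level_inv_iff`, `dominant_inv`, `twin_inv_iff`): generic
  members come in inverse pairs, and **the fixed members `q = q⁻¹` are exactly `q ∈ {0, 1, −1}`**
  (`inv_eq_self_iff`) — the degenerate member `𝔖(0)`, the summit point `𝔖(1) = ⟨2,2,2⟩` and the sign
  star `𝔖(−1) = 𝔖^♭` (`fam_neg_one`), i.e. precisely the three members the route has singled out.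
* §3 **The rotation transport for the `ᵀ` class, `ω`-free.**  Kernel VIII-e (`FarEdgeDescentTStarDoor`)
  identified the twin question for `𝔖^ᵀ` with lens-4's aside `BlockBelowMM` UNDER `ω = 2`, through
  `R̃(𝔖^ᵀ) = R̃(C₁)`.  Pointwise the transport needs no summit hypothesis: the asymptotic spectrum is
  closed under leg rotation (`isUniversal_rotatePoint`, lens 4) and `C₁`, `rotate 𝔖^ᵀ` are mutual
  restrictions (`map_coupling₁_eq_map_rotate_twistedStar`, lens 2 gen 29), so
  **`𝔖^ᵀ` is a spectral twin of `⟨2,2,2⟩` iff `C₁` is** (`twin_twistedStar_iff_twin_coupling₁`), iff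
  **`BlockBelowMM ∧ BlockOneIsMM`** (`twin_twistedStar_iff_blockBelowMM_and_blockOneIsMM`) — lens-4's
  two one-block leaves with equality; with lens-4's cut `ω = 2 ⟺ BlockOneIsMM ∧ CouplingMergeOptimal`
  the twin property of the single tensor `𝔖^ᵀ` plus the residual `CouplingMergeOptimal` gives `ω = 2`
  (`summit_of_twin_twistedStar`).

References: M. Bläser, M. Christandl, J. Zuiddam, *The border support rank of two-by-two matrix
multiplication is seven*, Chic. J. Theoret. Comput. Sci. 2018, §2–3 [BlaserChristandlZuiddam2017];
M. Bläser, *Fast Matrix Multiplication*, Theory of Computing Library 5 (2013), §5.1, Lemma 5.4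
[Blaser2013]; M. Christandl, P. Vrana, J. Zuiddam, J. AMS 36 (2023), Prop. 1.6
[ChristandlVranaZuiddam2023]; V. Strassen, J. reine angew. Math. 384 (1988), Thm. 2.3 [Strassen1988].
-/

noncomputable section

open scoped BigOperators

set_option linter.dupNamespace false

namespace Summit.MatrixMultiplication.MatrixMultiplication.Theorems.FarEdgeDescentStratumSymmetries

open Literature.Computability.AlgebraicComplexity
open Summit.MatrixMultiplication.MatrixMultiplication.Theorems.FarEdgeDescentTwistedStar (twistedStar)
open Summit.MatrixMultiplication.MatrixMultiplication.Theorems.FarEdgeDescentSignTwist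
open Summit.MatrixMultiplication.MatrixMultiplication.Theorems.FarEdgeDescentWeightFamily
open Summit.MatrixMultiplication.MatrixMultiplication.Theorems.FarEdgeDescentStratumPinning
open Summit.MatrixMultiplication.MatrixMultiplication.Theorems.OutsiderSandwichCoupling
  (coupling₁ CouplingMergeOptimal)
open Summit.MatrixMultiplication.MatrixMultiplication.Theorems.FarEdgeDescentCouplingBridge
  (map_coupling₁_eq_map_rotate_twistedStar)
open Summit.MatrixMultiplication.MatrixMultiplication.Theorems.OutsiderSandwichBlockOne
  (rotatePoint rotatePoint_apply isUniversal_rotatePoint rotatePoint_matMul BlockOneIsMM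
    summit_iff_blockOneIsMM)

/-! ## 1. The inversion involution `𝔖^w ↔ 𝔖^{w⁻¹}` -/

section Inversion

variable {K : Type} [Field K] {n L : ℕ}

/-- **`𝔖^w ≥ 𝔖^{w⁻¹}`** (restriction) for nowhere-zero `w`: swap the two leaves on the outer legs
and rescale the middle leg by `w⁻¹` (monomial restriction matrices). [cite: Blaser2013, Lemma 5.4] -/
theorem weightedStar_restrictsTo_inv (w : Fin n × Fin n → K) (hw : ∀ b, w b ≠ 0) :
    TensorRestrictsTo (weightedStar K n L w) (weightedStar K n L (fun b => (w b)⁻¹)) := by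
  classical
  refine ⟨fun a' a => if Sum.swap a' = a then 1 else 0, fun b' b => if b' = b then (w b')⁻¹ else 0,
    fun c' c => if Sum.swap c' = c then 1 else 0, fun a' b' c' => ?_⟩
  rw [Finset.sum_eq_single (Sum.swap a') (fun a _ ha => by simp [Ne.symm ha]) (by simp),
    Finset.sum_eq_single b' (fun b _ hb => by simp [Ne.symm hb]) (by simp),
    Finset.sum_eq_single (Sum.swap c') (fun c _ hc => by simp [Ne.symm hc]) (by simp)]
  rcases a' with a | a <;> rcases c' with c | c <;> simp [hw b']

/-- **`𝔖^{w⁻¹} ≥ 𝔖^w`**: the involution is its own inverse. [cite: Blaser2013, Lemma 5.4] -/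
theorem weightedStar_inv_restrictsTo (w : Fin n × Fin n → K) (hw : ∀ b, w b ≠ 0) :
    TensorRestrictsTo (weightedStar K n L (fun b => (w b)⁻¹)) (weightedStar K n L w) := by
  have h := weightedStar_restrictsTo_inv (L := L) (fun b => (w b)⁻¹) (fun b => inv_ne_zero (hw b))
  simpa only [inv_inv] using h

/-- **Every universal spectral point agrees on `𝔖^w` and `𝔖^{w⁻¹}`.** [cite: ChristandlVranaZuiddam2023, Prop. 1.6] -/
theorem spectralPoint_weightedStar_inv {F : SpectralMap K} (hF : IsUniversalSpectralPoint K F)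
    (w : Fin n × Fin n → K) (hw : ∀ b, w b ≠ 0) :
    F (weightedStar K n L (fun b => (w b)⁻¹)) = F (weightedStar K n L w) :=
  le_antisymm (hF.mono _ _ (weightedStar_restrictsTo_inv w hw))
    (hF.mono _ _ (weightedStar_inv_restrictsTo w hw))

/-- **`R̃(𝔖^{w⁻¹}) = R̃(𝔖^w)`** (`R̃ = max` over the asymptotic spectrum, which cannot tell the two
apart). [cite: ChristandlVranaZuiddam2023, Prop. 1.6] -/
theorem asymptoticRank_weightedStar_inv (w : Fin n × Fin n → K) (hw : ∀ b, w b ≠ 0) :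
    asymptoticRank (weightedStar K n L (fun b => (w b)⁻¹)) = asymptoticRank (weightedStar K n L w) := by
  refine le_antisymm ?_ ?_
  · obtain ⟨F, hF, hFt⟩ :=
      (strassen_duality_asymptoticRank_holds K (weightedStar K n L (fun b => (w b)⁻¹))).2
    rw [← hFt, spectralPoint_weightedStar_inv hF w hw]
    exact (strassen_duality_asymptoticRank_holds K (weightedStar K n L w)).1 F hF
  · obtain ⟨F, hF, hFt⟩ := (strassen_duality_asymptoticRank_holds K (weightedStar K n L w)).2
    rw [← hFt, ← spectralPoint_weightedStar_inv hF w hw]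
    exact (strassen_duality_asymptoticRank_holds K (weightedStar K n L (fun b => (w b)⁻¹))).1 F hF

end Inversion

/-! ## 2. The BCZ line: `q ↦ q⁻¹` -/

section Line

variable {K : Type} [Field K]

/-- The weight table of `𝔖(q⁻¹)` is the pointwise inverse of that of `𝔖(q)` (for every `q`,
`0⁻¹ = 0` included). [cite: BlaserChristandlZuiddam2017, §2] -/
theorem famW_inv (q : K) : famW K q⁻¹ = fun b => (famW K q b)⁻¹ := by
  funext b
  by_cases hb : b = (1, 0) <;> simp [famW, hb]

/-- The weights of `𝔖(q)` do not vanish for `q ≠ 0` (any field; the tree's `famW_ne_zero` is the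
case `K = ℂ`). [folklore] -/
theorem famW_ne_zero_of_ne_zero {q : K} (hq : q ≠ 0) (b : Fin 2 × Fin 2) : famW K q b ≠ 0 := by
  by_cases hb : b = (1, 0) <;> simp [famW, hb, hq]

/-- **`𝔖(q) ≥ 𝔖(q⁻¹)`** for `q ≠ 0`. [cite: BlaserChristandlZuiddam2017, §2] -/
theorem fam_restrictsTo_fam_inv {q : K} (hq : q ≠ 0) : TensorRestrictsTo (fam K q) (fam K q⁻¹) := by
  rw [fam, fam, famW_inv]
  exact weightedStar_restrictsTo_inv (famW K q) (famW_ne_zero_of_ne_zero hq)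

/-- **`𝔖(q⁻¹) ≥ 𝔖(q)`** for `q ≠ 0`. [cite: BlaserChristandlZuiddam2017, §2] -/
theorem fam_inv_restrictsTo_fam {q : K} (hq : q ≠ 0) : TensorRestrictsTo (fam K q⁻¹) (fam K q) := by
  rw [fam, fam, famW_inv]
  exact weightedStar_inv_restrictsTo (famW K q) (famW_ne_zero_of_ne_zero hq)

/-- **`F(𝔖(q⁻¹)) = F(𝔖(q))`** for every universal spectral point and EVERY `q`. [cite: ChristandlVranaZuiddam2023, Prop. 1.6] -/
theorem spectralPoint_fam_inv {F : SpectralMap K} (hF : IsUniversalSpectralPoint K F) (q : K) :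
    F (fam K q⁻¹) = F (fam K q) := by
  rcases eq_or_ne q 0 with rfl | hq
  · rw [inv_zero]
  · exact le_antisymm (hF.mono _ _ (fam_restrictsTo_fam_inv hq))
      (hF.mono _ _ (fam_inv_restrictsTo_fam hq))

/-- **`R̃(𝔖(q⁻¹)) = R̃(𝔖(q))`** for every `q`: the asymptotic rank along the BCZ line is invariant
under the Möbius involution `q ↦ q⁻¹`. [cite: BlaserChristandlZuiddam2017, §2] -/
theorem asymptoticRank_fam_inv (q : K) : asymptoticRank (fam K q⁻¹) = asymptoticRank (fam K q) := by
  rcases eq_or_ne q 0 with rfl | hq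
  · rw [inv_zero]
  · rw [fam, fam, famW_inv]
    exact asymptoticRank_weightedStar_inv (famW K q) (famW_ne_zero_of_ne_zero hq)

/-- **The fixed members of the involution are `q ∈ {0, 1, −1}`**: the degenerate member `𝔖(0)`,
the summit point `𝔖(1) = ⟨2,2,2⟩` and the sign star `𝔖(−1) = 𝔖^♭`. [folklore] -/
theorem inv_eq_self_iff (q : K) : q⁻¹ = q ↔ q = 0 ∨ q = 1 ∨ q = -1 := by
  constructor
  · intro h
    rcases eq_or_ne q 0 with hq | hq
    · exact Or.inl hq
    · have h1 : q * q = 1 := by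
        calc q * q = q⁻¹ * q := by rw [h]
          _ = 1 := inv_mul_cancel₀ hq
      exact Or.inr (mul_self_eq_one_iff.1 h1)
  · rintro (rfl | rfl | rfl) <;> simp

/-- The three fixed members, by name: `𝔖(0)`, `𝔖(1) = 𝔖_{id} ≅ ⟨2,2,2⟩`, `𝔖(−1) = 𝔖^♭`. [folklore] -/
theorem fixed_members :
    fam K 1 = FarEdgeDescentTwistRigidity.permStar K 2 1 (Equiv.refl _) ∧ fam K (-1) = signStar K :=
  ⟨fam_one K, fam_neg_one K⟩

/-- Off the fixed points the members come in inverse PAIRS `{q, q⁻¹}`, `q⁻¹ ≠ q`. [folklore] -/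
theorem inv_ne_self {q : K} (h0 : q ≠ 0) (h1 : q ≠ 1) (h2 : q ≠ -1) : q⁻¹ ≠ q := fun h => by
  rcases (inv_eq_self_iff q).1 h with h | h | h
  · exact h0 h
  · exact h1 h
  · exact h2 h

end Line

/-! ### The lens sets on the line are inversion-closed (over `ℂ`) -/

section LensSets

/-- **The flat set is inversion-closed**: `R̃(𝔖(q⁻¹)) ≤ r ⟺ R̃(𝔖(q)) ≤ r`. [cite: BlaserChristandlZuiddam2017, §2] -/
theorem le_level_inv_iff (q : ℂ) (r : ℝ) :
    asymptoticRank (fam ℂ q⁻¹) ≤ r ↔ asymptoticRank (fam ℂ q) ≤ r := by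
  rw [asymptoticRank_fam_inv]

/-- **The special set below any attained value is inversion-closed**:
`R̃(𝔖(q⁻¹)) < R̃(𝔖(q₀)) ⟺ R̃(𝔖(q)) < R̃(𝔖(q₀))`. [cite: BlaserChristandlZuiddam2017, §2] -/
theorem lt_level_inv_iff (q q₀ : ℂ) :
    asymptoticRank (fam ℂ q⁻¹) < asymptoticRank (fam ℂ q₀) ↔
      asymptoticRank (fam ℂ q) < asymptoticRank (fam ℂ q₀) := by
  rw [asymptoticRank_fam_inv]

/-- **Dominant moduli come in inverse pairs**: if `𝔖(q₀)` has the largest asymptotic rank on the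
line, so does `𝔖(q₀⁻¹)`. [cite: BlaserChristandlZuiddam2017, §2] -/
theorem dominant_inv {q₀ : ℂ} (hq₀ : ∀ q, asymptoticRank (fam ℂ q) ≤ asymptoticRank (fam ℂ q₀)) :
    ∀ q, asymptoticRank (fam ℂ q) ≤ asymptoticRank (fam ℂ q₀⁻¹) := fun q => by
  rw [asymptoticRank_fam_inv]
  exact hq₀ q

/-- **Flat members come in inverse pairs**: `R̃(𝔖(q)) ≤ 4 ⟹ R̃(𝔖(q⁻¹)) ≤ 4`. [cite: BlaserChristandlZuiddam2017, §2] -/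
theorem flat_inv {q : ℂ} (h : asymptoticRank (fam ℂ q) ≤ 4) : asymptoticRank (fam ℂ q⁻¹) ≤ 4 :=
  (le_level_inv_iff q 4).2 h

/-- **Spectral twins of `⟨2,2,2⟩` come in inverse pairs**: `𝔖(q⁻¹)` is a twin iff `𝔖(q)` is. [cite: ChristandlVranaZuiddam2023, Prop. 1.6] -/
theorem twin_inv_iff (q : ℂ) :
    (∀ F, IsUniversalSpectralPoint ℂ F → F (fam ℂ q⁻¹) = F (matMulTensor ℂ 2 2 2)) ↔
      (∀ F, IsUniversalSpectralPoint ℂ F → F (fam ℂ q) = F (matMulTensor ℂ 2 2 2)) := by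
  refine forall_congr' fun F => forall_congr' fun hF => ?_
  rw [spectralPoint_fam_inv hF q]

/-- The pointwise version: the whole spectral profile `F ↦ F(𝔖(q))` of a member is shared with its
inverse partner. [cite: ChristandlVranaZuiddam2023, Prop. 1.6] -/
theorem spectralProfile_inv (q : ℂ) :
    (fun F : {F : SpectralMap ℂ // IsUniversalSpectralPoint ℂ F} => F.1 (fam ℂ q⁻¹)) =
      fun F => F.1 (fam ℂ q) :=
  funext fun F => spectralPoint_fam_inv F.2 q

end LensSets

/-! ## 3. The `ᵀ` class: rotation transport to `C₁`, without `ω` -/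

section Transport

/-- `F(C₁) = F_C(𝔖^ᵀ)` for every universal spectral point: the rotated point evaluated on the
transposed star (`C₁` and `rotate 𝔖^ᵀ` are mutual restrictions). [cite: Strassen1988, Thm. 2.3] -/
theorem map_coupling₁_eq_rotatePoint_twistedStar {F : SpectralMap ℂ}
    (hF : IsUniversalSpectralPoint ℂ F) : F coupling₁ = rotatePoint F (twistedStar ℂ 2 1) := by
  rw [rotatePoint_apply]
  exact map_coupling₁_eq_map_rotate_twistedStar hF

/-- `F(𝔖^ᵀ) = F_{C²}(C₁)`: un-rotating (`rotate³ = id`). [cite: Strassen1988, Thm. 2.3] -/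
theorem map_twistedStar_eq_rotatePoint₂_coupling₁ {F : SpectralMap ℂ}
    (hF : IsUniversalSpectralPoint ℂ F) :
    F (twistedStar ℂ 2 1) = rotatePoint (rotatePoint F) coupling₁ := by
  rw [map_coupling₁_eq_rotatePoint_twistedStar (isUniversal_rotatePoint (isUniversal_rotatePoint hF)),
    rotatePoint_apply, rotatePoint_apply, rotatePoint_apply]
  rfl

/-- **A twin on `𝔖^ᵀ` is a twin on `C₁`**: if every universal spectral point gives `𝔖^ᵀ` the value of
`⟨2,2,2⟩`, then every universal spectral point gives `C₁` the value of `⟨2,2,2⟩` (apply the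
hypothesis to the rotated point; `F_C⟨2,2,2⟩ = F⟨2,2,2⟩`). [cite: ChristandlVranaZuiddam2023, Prop. 1.6] -/
theorem twin_coupling₁_of_twin_twistedStar
    (h : ∀ F, IsUniversalSpectralPoint ℂ F → F (twistedStar ℂ 2 1) = F (matMulTensor ℂ 2 2 2))
    {F : SpectralMap ℂ} (hF : IsUniversalSpectralPoint ℂ F) : F coupling₁ = F (matMulTensor ℂ 2 2 2) := by
  rw [map_coupling₁_eq_rotatePoint_twistedStar hF, h _ (isUniversal_rotatePoint hF),
    rotatePoint_matMul hF]

/-- **A twin on `C₁` is a twin on `𝔖^ᵀ`** (apply the hypothesis to the twice-rotated point). [cite: ChristandlVranaZuiddam2023, Prop. 1.6] -/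
theorem twin_twistedStar_of_twin_coupling₁
    (h : ∀ F, IsUniversalSpectralPoint ℂ F → F coupling₁ = F (matMulTensor ℂ 2 2 2))
    {F : SpectralMap ℂ} (hF : IsUniversalSpectralPoint ℂ F) :
    F (twistedStar ℂ 2 1) = F (matMulTensor ℂ 2 2 2) := by
  rw [map_twistedStar_eq_rotatePoint₂_coupling₁ hF,
    h _ (isUniversal_rotatePoint (isUniversal_rotatePoint hF)),
    rotatePoint_matMul (isUniversal_rotatePoint hF), rotatePoint_matMul hF]

/-- **`𝔖^ᵀ ~ ⟨2,2,2⟩ ⟺ C₁ ~ ⟨2,2,2⟩`** (spectral twins), with no hypothesis on `ω`. [cite: ChristandlVranaZuiddam2023, Prop. 1.6] -/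
theorem twin_twistedStar_iff_twin_coupling₁ :
    (∀ F, IsUniversalSpectralPoint ℂ F → F (twistedStar ℂ 2 1) = F (matMulTensor ℂ 2 2 2)) ↔
      (∀ F, IsUniversalSpectralPoint ℂ F → F coupling₁ = F (matMulTensor ℂ 2 2 2)) :=
  ⟨fun h _ hF => twin_coupling₁_of_twin_twistedStar h hF,
    fun h _ hF => twin_twistedStar_of_twin_coupling₁ h hF⟩

/-- **The twin question for `𝔖^ᵀ` is lens-4's pair of one-block leaves with equality, `ω`-free:
`𝔖^ᵀ ~ ⟨2,2,2⟩ ⟺ BlockBelowMM ∧ BlockOneIsMM`** (`C₁ ≲ ⟨2,2,2⟩` and `⟨2,2,2⟩ ≲ C₁` at every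
universal spectral point).  Kernel VIII-e had this only under `ω = 2`. [cite: ChristandlVranaZuiddam2023, Prop. 1.6] -/
theorem twin_twistedStar_iff_blockBelowMM_and_blockOneIsMM :
    (∀ F, IsUniversalSpectralPoint ℂ F → F (twistedStar ℂ 2 1) = F (matMulTensor ℂ 2 2 2)) ↔
      (Theses.OutsiderSandwich.BlockBelowMM ∧ Theses.OutsiderSandwich.BlockOneIsMM) := by
  rw [twin_twistedStar_iff_twin_coupling₁]
  constructor
  · intro h
    exact ⟨fun F hF => (h F hF).le, fun F hF => (h F hF).ge⟩
  · rintro ⟨hle, hge⟩ F hF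
    exact le_antisymm (hle F hF) (hge F hF)

/-- **A twin `𝔖^ᵀ ~ ⟨2,2,2⟩` gives lens-4's leaf `BlockOneIsMM`** (`⟨2,2,2⟩ ≲ C₁`). [cite: ChristandlVranaZuiddam2023, Prop. 1.6] -/
theorem blockOneIsMM_of_twin_twistedStar
    (h : ∀ F, IsUniversalSpectralPoint ℂ F → F (twistedStar ℂ 2 1) = F (matMulTensor ℂ 2 2 2)) :
    BlockOneIsMM :=
  fun _ hF => (twin_coupling₁_of_twin_twistedStar h hF).ge

/-- **Twin plus lens-4's residual decide the summit**: `𝔖^ᵀ ~ ⟨2,2,2⟩ ⟹ CouplingMergeOptimal ⟹ ω = 2`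
(lens-4's cut `ω = 2 ⟺ BlockOneIsMM ∧ CouplingMergeOptimal`). [cite: Strassen1988, Thm. 2.3] -/
theorem summit_of_twin_twistedStar
    (h : ∀ F, IsUniversalSpectralPoint ℂ F → F (twistedStar ℂ 2 1) = F (matMulTensor ℂ 2 2 2))
    (hR : CouplingMergeOptimal) : _root_.MatrixMultiplication :=
  summit_iff_blockOneIsMM.2 ⟨blockOneIsMM_of_twin_twistedStar h, hR⟩

/-- Conversely **`ω = 2 ∧ BlockBelowMM ⟹ 𝔖^ᵀ ~ ⟨2,2,2⟩`** (the leaf `BlockOneIsMM` is necessary for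
the summit, lens 4). [cite: Strassen1988, Thm. 2.3] -/
theorem twin_twistedStar_of_summit_of_blockBelowMM (hS : _root_.MatrixMultiplication)
    (hB : Theses.OutsiderSandwich.BlockBelowMM) :
    ∀ F, IsUniversalSpectralPoint ℂ F → F (twistedStar ℂ 2 1) = F (matMulTensor ℂ 2 2 2) :=
  twin_twistedStar_iff_blockBelowMM_and_blockOneIsMM.2 ⟨hB, (summit_iff_blockOneIsMM.1 hS).1⟩

end Transport

end Summit.MatrixMultiplication.MatrixMultiplication.Theorems.FarEdgeDescentStratumSymmetries

end
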